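import Summits.CriticalPhenomena.Ising3DConformalLimit.Theses.PerfectScreening
import Summits.CriticalPhenomena.Ising3DConformalLimit.Theorems.GaussianLimitNotScreened.Negative.Reformulation
import Summits.CriticalPhenomena.Ising3DConformalLimit.Theorems.PerfectScreeningGaussianLimitNotScreenedItemWiring
import Summits.CriticalPhenomena.Ising3DConformalLimit.Theorems.PerfectScreeningGaussianLimitNotScreenedFatSpreadCluster
import Summits.CriticalPhenomena.Ising3DConformalLimit.Theorems.PerfectScreeningGaussianLimitNotScreenedHalfOneReduction
import Summits.CriticalPhenomena.Ising3DConformalLimit.Theorems.PerfectScreeningGaussianLimitNotScreenedSplit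
import Summits.CriticalPhenomena.Ising3DConformalLimit.Theorems.PerfectScreeningGaussianLimitNotScreenedInterlacingBridges
import Summits.CriticalPhenomena.Ising3DConformalLimit.Theorems.PerfectScreeningGaussianLimitNotScreenedWindowOfAxialCapacity
import Summits.CriticalPhenomena.Ising3DConformalLimit.Theorems.PerfectScreeningGaussianLimitNotScreenedAmplitudeFloorDCP
import Summits.CriticalPhenomena.Ising3DConformalLimit.Theorems.PerfectScreeningGaussianLimitNotScreenedRenormBoundDCP
import Summits.CriticalPhenomena.Ising3DConformalLimit.Theorems.PerfectScreeningGaussianLimitNotScreenedCornerOfScreenedAxisLower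
import Summits.CriticalPhenomena.Ising3DConformalLimit.Theorems.PerfectScreeningGaussianLimitNotScreenedWindowAboveOfScreenedAxisLower
import Summits.CriticalPhenomena.Ising3DConformalLimit.Theorems.LatticeSDPCertificatesWindowBelowHalf
import Summits.CriticalPhenomena.Ising3DConformalLimit.Theorems.LatticeSDPCertificatesCriticalStateFeasible
import HarnessLib
import HarnessLib.Audit

/-!
# Line `free-regular-variation-dcp-window` for crux `GaussianLimitNotScreened`
# (stmt-CriticalPhenomena-13886, route PerfectScreening r4) — RESHAPED skeleton, lead c4; re-owned by lead c5 (2026-08-17)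

Lead c4 (`prover-line-stmt-CriticalPhenomena-13886-c4-0`, 2026-08-17), continuation of leads 0 / c1 / c2 / c3.
The planner's skeleton `Cruxes/GaussianLimitNotScreened/Lines/free_regular_variation_dcp_window.lean` @fb5d3ae678ca
(stubs `stub_gaussianGluing` ⟺ crux below `3/4`, `stub_noMarginalGaussianLimit` = corner) is the Δ-ANATOMY FRAME of
the crux; its thin stub is dead (c3, `Lines/free-regular-variation-dcp-window-dead.md`). This reshape replaces
`stub_gaussianGluing` by the two regimes it conflated, so that the REGISTERED stub list of the crux is exactly the
crux-strategist's three-regime split D1 (`Cruxes/GaussianLimitNotScreened/StrategySplit.lean` @033166fabde4,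
`STRATEGY-CENSUS.md`; glue landed by this seat as `Theorems/PerfectScreeningGaussianLimitNotScreenedSplit.lean`, p137467):

* (β) `stub_noGaussianWindowLimit` — no non-degenerate Möbius limit of `criticalCorr 3` with `1/2 < Δ < 3/4` is
  Gaussian (screening is automatic there, `screened_of_half_lt`). OPEN; payers by landed bridges (this file, §Payers):
  item stmt-CriticalPhenomena-0636 `IsingEuclidUpgradeR4NonGaussian`, item stmt-CriticalPhenomena-2601
  `GaussianLimitIsFree`, the karamata line's hypothesis-free `stub_isingCapacity` (fat spread cluster p102368).
* (γ) `stub_noMarginalGaussianLimit` — none at the corner `Δ = 3/4` (verbatim the planner's STUB 2). OPEN; payers: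
  item stmt-CriticalPhenomena-5507 `WindowBelowHalf` (p102368 `noMarginalGaussianLimit_of_windowBelowHalf`), item 2601,
  item stmt-CriticalPhenomena-5504 `CertifiedWindow` (+ landed `criticalStateFeasible_proof`), item 15703 `SubPtolemyFloor`
  (with `Interlacing`, p137971).
* (α) `stub_amplitudeAtHalf` — at `Δ = 1/2` the wave-function renormalisation `Z_m = m/ρ(1/m)²` does not tend to `0`
  (verbatim the registered stub D of line single-layer-linear-regression, c2/c3). OPEN, the hardest, held by the lead;
  payers: crux stmt-CriticalPhenomena-13885's `stub_isingCapacityAxial` (p128872), item 0636 (vacuity), item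
  stmt-CriticalPhenomena-1343 `GaussianLimitIsCoulomb`, and — NEW, of a different kind, landed by this seat as
  `Theorems/PerfectScreeningGaussianLimitNotScreenedInterlacingBridges.lean` (p137971) — item stmt-CriticalPhenomena-15702
  `SubPtolemyInterlacing.Interlacing` (a lattice four-point inequality, false for Wick families, MC-supported, live
  lead seat): `stub_interlacingPaysAmplitude : Interlacing → (α)` because `Interlacing` forbids Gaussian Möbius limits
  with `2Δ < log₂(1+√2) ≈ 1.2716` (landed `SubPtolemyFloorHybrid.hasNontrivialU4_of_interlacing_of_window`); it also
  pays (β) on `(1/2, 0.6358)` (`noGaussianWindowLimit_below_of_interlacing`), so GIVEN `Interlacing` the crux reduces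
  to the upper window `[0.6358, 3/4)` + corner (`gaussianLimitNotScreened_of_interlacing_of_upperWindow_of_corner`),
  and `Interlacing ∧ {2601 | 15703 SubPtolemyFloor | conditional η < 0.2716} ⇒ crux` outright.

LEAD c5 ADDENDUM (prover-line-stmt-CriticalPhenomena-13886-c5-0, 2026-08-17T03:10Z). Two bookkeeping stubs registered, proved by
one wave of stub-workers and LANDED, then imported here (registry back to the three leaves): P1 `stub_amplitudeFloorDCP`
(p139935) — for EVERY non-degenerate Möbius-covariant pointwise limit of `criticalCorr 3`, `n³⟨σ₀σ_{ne₀}⟩² ≥ c` eventually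
(DCP25 Thm 1.3, a tree theorem, + Karamata dyadic sums): the amplitude-sharp form of `Δ ≤ 3/4`, so at the corner the slowly
varying amplitude is bounded below and (γ) reads "no Gaussian Möbius limit at `Δ = 3/4` with `ℓ ≳ 1`" (`cornerAmplitude_floor`);
P3 `stub_renormBoundDCP` (p140242) — `ρ(1/m)² = O(m^{3/2})` for every Möbius limit, so at the corner `¬ ρ(1/m)²/m^{3/2} → ∞` OUTRIGHT
(`cornerRenorm_not_tendsto_atTop`, the Δ = 3/4 counterpart of leaf (α)); P2 `stub_windowOfAxialCapacityAt` (p139690) — the axial Ising capacity AT exponent `s` forbids Gaussian Möbius limits with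
`Δ < (3 − s)/2`, so crux 13885's registered `stub_isingCapacityAxial` (`∃ s < 2`) pays (α) and (β)∣(1/2,(3−s)/2) only
(`noGaussianWindowLimit_below_of_isingCapacityAxial`), the whole window needing every `s > 3/2`. Leaf audit of the wave
(03:00Z): (β) stub-blocked on item 0636, (γ) stub-blocked on item 5507 (also 5504, 2601, 15702 ∧ 15703), (α) held: no lever
passing the strategist's admissibility test (A1)–(A4) exists in tree or print (see `Cruxes/GaussianLimitNotScreened/NOTES.md` §7).

LEAD c7 (prover-line-stmt-CriticalPhenomena-13886-c7-0, 2026-08-17T05:20Z), cycle 1. TWO bookkeeping stubs registered, proved by one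
wave of 2 stub-workers, LANDED (F1 p142307, F2 p142830) and imported here (registry back to the three leaves, 3 sorries); both wire the
leaves to the NEWEST external statement family — crux 15703
`SubPtolemyFloor`'s line `source-cluster-screening` (landed `SubPtolemyFloorScreening.etaBound_of_screenedAxisLower`, p141599,
04:28Z: the screened axial lower bound of Duminil-Copin–Panis Thm 1.3 with a polynomial gain `n^{s}`, `ScreenedAxisLower s`,
forces `η ≤ (1 − s)/2` whenever `η` exists; for a Möbius limit `η = 2Δ − 1` exists, `dimension_window_and_eta`):
F1 `stub_cornerOfScreenedAxisLower` — `ScreenedAxisLower s` at ANY `s > 0` pays leaf (γ) (the corner has `η = 1/2 > (1−s)/2`);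
F2 `stub_windowAboveOfScreenedAxisLower` — `ScreenedAxisLower s` kills every Möbius limit with `Δ > (3 − s)/4`, so with
`Interlacing` (2Δ < log₂(1+√2)) leaf (β) follows as soon as `s ≥ 3 − 2·log₂(1+√2) ≈ 0.457`, exactly the exponent range of
15703's registered `stub_screenedLemma25`. Payer-map corrections recorded with them: (γ) ⟸ item 15703 ALONE and
(β)∣[log₂(1+√2)/2, 3/4) ⟸ 15703 alone (through the landed `conditionalEta_of_subPtolemyFloor`: η < 0.2716 if it exists),
not only `15702 ∧ 15703` as §6 of the crux NOTES has it.

COMPOSITION `GaussianLimitNotScreened_of` (no hypotheses) = the strategist's glue `gaussianLimitNotScreened_of_subs` (LANDED by this seat, p137467) applied to the three stubs: window `Δ ∈ [1/2, 3/4]`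
(`dimension_window_and_eta`, DCP25 Thm 1.5) ⇒ three regimes; (β)/(γ) contradict `U₄ ≡ 0`; at `Δ = 1/2` perfect
screening is `ρ(1/m)²/m → ∞` (`screened_iff_renorm`), forbidden by (α). EXACTNESS (`…_of_crux` lemmas): each stub
is implied by the crux, so none is stronger than needed (`crux_iff_half_and_amplitude`).

DISPROOF USED (`Cruxes/GaussianLimitNotScreened/Disproof.lean` v4 @27f83d55ad39, unchanged since 2026-08-16T05:07Z, no
`-- Targets` section; landed `Theorems/GaussianLimitNotScreened/Negative/{ModelBlind,ModelBlindSharp,ModelBlindAllOrders,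
Reformulation}.lean`): (a1)–(a3) the model-blind crux is false at every order (screened hafnian witness → free field) —
honoured: every stub quantifies over limits of `criticalCorr 3` itself; (d) `crux_iff_half_and_amplitude`,
`screened_iff_renorm`, `screened_of_half_lt`, `dimension_window_and_eta` ARE the composition; (d2) `not_halfOne_blind`
(`gffLattice (3/5)` kills a model-blind (β)), `not_halfTwo_blind` (`screenedLattice` kills a model-blind (α)); (e1)/(e2):
translation invariance and the n.n. DLR structure are both load-bearing for (α); HANDOFF (iii): any lattice identity
for `Z_m` must FAIL on `screenedLatticeAll`. `ledger negatives --problem CriticalPhenomena`: none on this sub-problem.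
-/

noncomputable section

open Filter Topology Set
open Literature.Probability.LatticeModels
open Summit.CriticalPhenomena.Ising3DConformalLimit.GaussianLimitNotScreenedNegative
  (screened_iff_renorm dimension_window_and_eta screened_of_half_lt crux_iff_half_and_amplitude)
open Summit.CriticalPhenomena.Ising3DConformalLimit.Cruxes.IsingEuclidUpgradeR4NonGaussian.FreeCovarianceDeltaDichotomy
  (ScaleCovariantOn boxG)
open Summit.CriticalPhenomena.Ising3DConformalLimit.Cruxes.GaussianLimitNotScreened.KaramataAmplitudeBlindMerging
  (IsSpreadDefect defectG scaleCovariantOn_of_isMoebiusCovariant hasNontrivialU4_of_lt_threeQuarters_of_capacity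
    noMarginalGaussianLimit_of_windowBelowHalf noMarginalGaussianLimit_of_gaussianLimitIsFree)
open Summit.CriticalPhenomena.Ising3DConformalLimit.Cruxes.GaussianLimitNotScreened.SingleLayerLinearRegression
  (amplitudeAtHalf_of_isingCapacityAxial')
open Summit.CriticalPhenomena.Ising3DConformalLimit.PerfectScreeningGaussianLimitNotScreenedSplit
  (gaussianLimitNotScreened_of_subs gaussianLimitNotScreened_iff_subs)

namespace Summit.CriticalPhenomena.Ising3DConformalLimit.Cruxes.GaussianLimitNotScreened.FreeRegularVariationDcpWindow

/-! ## The registered stubs (the three leaves of the split) -/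

/-- **STUB (β) — NO GAUSSIAN MÖBIUS LIMIT IN THE OPEN WINDOW `1/2 < Δ < 3/4` (OPEN).** A non-degenerate
Möbius-covariant pointwise scaling limit of `criticalCorr 3` with `1/2 < Δ < 3/4` has `U₄ ≢ 0`. There the lattice
two-point function is automatically perfectly screened (`screened_of_half_lt`), the bubble is top-heavy and the
four-current (fat) clusters glue with probability `≥ c` (landed `stub_fatStep`, crux 0636), so the content is the
THIN gluing / meeting-robustness problem of nearest-neighbour Ising₃ — crux 0636 restricted to the window, or item
2601's Markov rigidity (`Δ = 1/2` for Gaussian limits). Model-blind FALSE (`not_halfOne_blind`: the sampled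
generalised free field `gffLattice (3/5)`), so locality of `criticalCorr 3` must enter. Why it might fail: only if
critical Ising₃ had a free conformal limit with `η ∈ (0, 1/2)` (bootstrap/MC: `η ≈ 0.036` but interacting).
[cite: AizenmanDuminilCopinAnnals2021, eq. (3.11) and Lemma 4.4] [cite: Kotani1973, Theorem 2] -/
theorem stub_noGaussianWindowLimit :
    ∀ (ρ : ℝ → ℝ) (Δ : ℝ) (S : CorrFamily 3), (∀ δ ∈ Set.Ioc (0:ℝ) 1, 0 < ρ δ) →
      HasPointwiseScalingLimit (criticalCorr 3) ρ S → IsNondegenerateTwoPoint S →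
      IsMoebiusCovariant Δ S → 1 / 2 < Δ → Δ < 3 / 4 → HasNontrivialU4 S := by
  sorry

/-- **STUB (γ) — THE MARGINAL CORNER `Δ = 3/4` (OPEN; verbatim the planner's STUB 2).** A non-degenerate Möbius
limit of `criticalCorr 3` with `Δ = 3/4` (`η = 1/2`, the Duminil-Copin–Panis endpoint) is not Gaussian. Currents are
exactly marginal there (`B_R ≍ R³G(R)²·log R`, tree barrier `LongRangeTrivialityOnZ3MarginalAudit`: the RP long-range
model at `α = 3/2` realises the scenario model-blind), so the payers are two-point strictness — item
stmt-CriticalPhenomena-5507 `WindowBelowHalf` (`η_eff < 1/2` between any two scales; landed bridge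
`noMarginalGaussianLimit_of_windowBelowHalf`) — or locality, item stmt-CriticalPhenomena-2601 (landed bridge
`noMarginalGaussianLimit_of_gaussianLimitIsFree`). [cite: DuminilCopinPanis2025LowerBounds, Theorem 1.5] -/
theorem stub_noMarginalGaussianLimit :
    ∀ (ρ : ℝ → ℝ) (S : CorrFamily 3), (∀ δ ∈ Set.Ioc (0:ℝ) 1, 0 < ρ δ) →
      HasPointwiseScalingLimit (criticalCorr 3) ρ S → IsNondegenerateTwoPoint S →
      IsMoebiusCovariant (3 / 4) S → HasNontrivialU4 S := by
  sorry

/-- **STUB (α) — AMPLITUDE AT `Δ = 1/2` (OPEN; THE HARDEST STUB, held by the lead; verbatim the registered stub D of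
line single-layer-linear-regression).** For a non-degenerate Möbius-covariant GAUSSIAN pointwise limit of
`criticalCorr 3` with `Δ = 1/2`, the renormalisation is canonical along a subsequence: `¬ ρ(1/m)²/m → ∞`, i.e. the
wave-function renormalisation `Z_m = m/ρ(1/m)²` does not tend to `0` ("a free limit of the nearest-neighbour model is
mean-field normalised", the `d = 3` analogue of `G ≥ c|x|^{2−d}`, DCP25 Thm 1.4 for `d ≥ 5`). Model-blind FALSE
(`not_halfTwo_blind`, `cruxWithoutIsingSharp_false`, `cruxWithoutIsing_false'`: the screened hafnian family
`screenedLatticeAll` with `ρ²δ = 1 − log δ`); translation invariance AND the n.n. DLR structure of `criticalCorr 3`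
are both load-bearing (Disproof (e1)/(e2)); no printed lattice-to-continuum amplitude rigidity exists below `d = 5`
(open even for `d = 4`, where Gaussianity is a theorem: DCP25 Thm 1.4 gives only `c/(|x|² log|x|)`). Payers by
landed bridges: crux 13885's `stub_isingCapacityAxial` (`amplitudeAtHalf_of_isingCapacityAxial'`, p128872), item
0636 (vacuity), item 1343 `GaussianLimitIsCoulomb` (`amplitudeAtHalf_of_gaussianLimitIsCoulomb` below).
[cite: DuminilCopinPanis2025LowerBounds, Theorem 1.4] [cite: Newman1975Gaussian, Theorem 3] -/
theorem stub_amplitudeAtHalf :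
    ∀ (ρ : ℝ → ℝ) (S : CorrFamily 3), (∀ δ ∈ Set.Ioc (0:ℝ) 1, 0 < ρ δ) →
      HasPointwiseScalingLimit (criticalCorr 3) ρ S → IsNondegenerateTwoPoint S →
      IsMoebiusCovariant (1/2) S → ¬ HasNontrivialU4 S →
      ¬ Tendsto (fun m : ℕ => ρ (1 / m) ^ 2 / m) atTop atTop := by
  sorry

/-! ## Bookkeeping stubs of lead c7, cycle 1 — LANDED (imported, not redeclared)
F1 `stub_cornerOfScreenedAxisLower` (p142307, Theorems/PerfectScreeningGaussianLimitNotScreenedCornerOfScreenedAxisLower.lean): crux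
15703's line proposition `ScreenedAxisLower s` (Duminil-Copin–Panis Thm 1.3 at `d = 3` with a gain `n^{s}`, unfolded verbatim as in the
landed `SubPtolemyFloorScreening.etaBound_of_screenedAxisLower`, p141599) at ANY `s > 0` pays leaf (γ) (the corner has `η = 1/2`,
`hasIsingExponentEta_half_of_cornerLimit`, while the bound forces `η ≤ (1 − s)/2`); with it landed `noMarginalGaussianLimit_of_conditionalEtaHalf`
((γ) ⟸ "η < 1/2 if it exists") and `noMarginalGaussianLimit_of_subPtolemyFloor` ((γ) ⟸ item 15703 ALONE, via `conditionalEta_of_subPtolemyFloor`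
and `threshold_sub_one_lt_half : log₂(1+√2) − 1 < 1/2`).
F2 `stub_windowAboveOfScreenedAxisLower` (p142830, Theorems/PerfectScreeningGaussianLimitNotScreenedWindowAboveOfScreenedAxisLower.lean):
`ScreenedAxisLower s` kills every Möbius limit with `Δ > (3 − s)/4` (`dimension_le_of_screenedAxisLower`); with it landed
`noGaussianWindowLimit_upper_of_conditionalEta` / `…_of_subPtolemyFloor` ((β)∣[log₂(1+√2)/2, 3/4) ⟸ item 15703 alone),
`noGaussianWindowLimit_of_interlacing_of_subPtolemyFloor` ((β) verbatim ⟸ 15702 ∧ 15703), `noGaussianWindowLimit_of_interlacing_of_screenedAxisLower`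
((β) verbatim ⟸ `Interlacing` + `ScreenedAxisLower s` for `3 − 2·log₂(1+√2) < s`, the exponent range of 15703's registered `stub_screenedLemma25`),
`noMoebiusLimitAboveHalf_of_screenedAxisLower_one` / `dimension_eq_half_of_screenedAxisLower_one` (`s ≥ 1` pins `Δ = 1/2`, i.e. pays (β) ∧ (γ) = half (I);
for `s > 1` the hypothesis contradicts the infrared bound, so only `s = 1` has content there). -/

/-- Kernel check of the F1 wiring: `ScreenedAxisLower s` at one `s > 0` gives STUB (γ) verbatim. [folklore] -/
theorem noMarginalGaussianLimit_of_screenedAxisLower {s : ℝ} (hs : 0 < s)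
    (h13 : ∃ c₁ : ℝ, 0 < c₁ ∧ ∃ N₁ : ℕ, 0 < N₁ ∧ ∀ n : ℕ, N₁ ≤ n →
      c₁ * (n : ℝ) ^ s / ((∑ x ∈ box 3 (4 * n), twoPointFree 3 (criticalBeta 3) x) +
            (n : ℝ) ^ (3 - 2) *
              ∑ k ∈ Finset.Icc 1 (2 * n),
                (k : ℝ) * twoPointFree 3 (criticalBeta 3) (Pi.single (⟨0, by omega⟩ : Fin 3) (k : ℤ)))
        ≤ twoPointFree 3 (criticalBeta 3) (Pi.single (⟨0, by omega⟩ : Fin 3) (n : ℤ))) :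
    ∀ (ρ : ℝ → ℝ) (S : CorrFamily 3), (∀ δ ∈ Set.Ioc (0:ℝ) 1, 0 < ρ δ) →
      HasPointwiseScalingLimit (criticalCorr 3) ρ S → IsNondegenerateTwoPoint S →
      IsMoebiusCovariant (3 / 4) S → HasNontrivialU4 S :=
  stub_cornerOfScreenedAxisLower s hs h13

/-- Kernel check of the F2 wiring: `ScreenedAxisLower s` pays the part of STUB (β) above `(3 − s)/4`; in particular
for `s ≥ 1` it pays ALL of (β) (then `(3 − s)/4 ≤ 1/2`). [folklore] -/
theorem noGaussianWindowLimit_of_screenedAxisLower_one_le {s : ℝ} (hs : 1 ≤ s)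
    (h13 : ∃ c₁ : ℝ, 0 < c₁ ∧ ∃ N₁ : ℕ, 0 < N₁ ∧ ∀ n : ℕ, N₁ ≤ n →
      c₁ * (n : ℝ) ^ s / ((∑ x ∈ box 3 (4 * n), twoPointFree 3 (criticalBeta 3) x) +
            (n : ℝ) ^ (3 - 2) *
              ∑ k ∈ Finset.Icc 1 (2 * n),
                (k : ℝ) * twoPointFree 3 (criticalBeta 3) (Pi.single (⟨0, by omega⟩ : Fin 3) (k : ℤ)))
        ≤ twoPointFree 3 (criticalBeta 3) (Pi.single (⟨0, by omega⟩ : Fin 3) (n : ℤ))) :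
    ∀ (ρ : ℝ → ℝ) (Δ : ℝ) (S : CorrFamily 3), (∀ δ ∈ Set.Ioc (0:ℝ) 1, 0 < ρ δ) →
      HasPointwiseScalingLimit (criticalCorr 3) ρ S → IsNondegenerateTwoPoint S →
      IsMoebiusCovariant Δ S → 1 / 2 < Δ → Δ < 3 / 4 → HasNontrivialU4 S :=
  fun ρ Δ S hρ hlim hnd hM hgt _ =>
    stub_windowAboveOfScreenedAxisLower s (by linarith) h13 ρ Δ S hρ hlim hnd hM (by linarith)

/-! ## Bookkeeping stubs of lead c5 — LANDED (imported, not redeclared)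
`stub_amplitudeFloorDCP` (P1, p139935, Theorems/PerfectScreeningGaussianLimitNotScreenedAmplitudeFloorDCP.lean): for every
non-degenerate Möbius-covariant pointwise limit of `criticalCorr 3`, `n³ ⟨σ₀σ_{ne₀}⟩² ≥ c` eventually (DCP25 Thm 1.3, tree theorem,
fed with Karamata dyadic sums) — at the corner `Δ = 3/4` the amplitude `ℓ(n) = n^{3/2}G(ne₀)` is bounded below.
`stub_windowOfAxialCapacityAt` (P2, p139690, Theorems/PerfectScreeningGaussianLimitNotScreenedWindowOfAxialCapacity.lean): the axial
Ising capacity AT exponent `s` forbids Gaussian Möbius limits with `Δ < (3 − s)/2`; corollaries `noGaussianWindowLimit_of_isingCapacityAxialAll`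
((β) ⟸ axial capacity at every `s > 3/2`) and `amplitudeAtHalf_of_isingCapacityAxialAt` ((α) ⟸ axial capacity at one `s < 2`).
`stub_renormBoundDCP` (P3, p140242, Theorems/PerfectScreeningGaussianLimitNotScreenedRenormBoundDCP.lean): `ρ(1/m)² ≤ C·m^{3/2}`
eventually for every Möbius limit; `cornerRenorm_not_tendsto_atTop`: at `Δ = 3/4`, `¬ ρ(1/m)²/m^{3/2} → ∞` outright — the corner
counterpart of leaf (α) is a theorem. -/

/-- Kernel re-check of the P1 wiring at the corner: under the hypotheses of STUB (γ) the axial amplitude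
`n^{3/2}⟨σ₀σ_{ne₀}⟩_{β_c}` is bounded away from `0` — so (γ) is exactly "no Gaussian Möbius limit at `Δ = 3/4` with a
non-vanishing amplitude"; the degenerate scenario `ℓ → 0` at the corner is already excluded by DCP25 Thm 1.3.
[cite: DuminilCopinPanis2025LowerBounds, Theorem 1.3] -/
theorem cornerAmplitude_floor {ρ : ℝ → ℝ} {S : CorrFamily 3} (hρ : ∀ δ ∈ Set.Ioc (0:ℝ) 1, 0 < ρ δ)
    (hlim : HasPointwiseScalingLimit (criticalCorr 3) ρ S) (hnd : IsNondegenerateTwoPoint S)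
    (hM : IsMoebiusCovariant (3 / 4) S) :
    ∃ c : ℝ, 0 < c ∧ ∀ᶠ n : ℕ in atTop, c ≤ (n : ℝ) ^ 3 * criticalTwoPoint 3 (Pi.single 0 (n : ℤ)) ^ 2 :=
  stub_amplitudeFloorDCP ρ (3 / 4) S hρ hlim hnd hM

/-- Kernel re-check of the P3 wiring: under the hypotheses of STUB (γ), `¬ ρ(1/m)²/m^{3/2} → ∞` (imported
`cornerRenorm_not_tendsto_atTop`) — the exact Δ = 3/4 analogue of STUB (α)'s conclusion holds for every Möbius limit.
[cite: DuminilCopinPanis2025LowerBounds, Theorem 1.3] -/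
theorem cornerRenorm_canonical {ρ : ℝ → ℝ} {S : CorrFamily 3} (hρ : ∀ δ ∈ Set.Ioc (0:ℝ) 1, 0 < ρ δ)
    (hlim : HasPointwiseScalingLimit (criticalCorr 3) ρ S) (hnd : IsNondegenerateTwoPoint S)
    (hM : IsMoebiusCovariant (3 / 4) S) :
    ¬ Tendsto (fun m : ℕ => ρ (1 / m) ^ 2 / (m : ℝ) ^ (3 / 2 : ℝ)) atTop atTop :=
  cornerRenorm_not_tendsto_atTop hρ hlim hnd hM

/-- Kernel re-check of the P2 wiring: 13885's registered `stub_isingCapacityAxial` (`∃ s ∈ (0,2)`, axial capacity at `s`)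
pays STUB (α) (imported `amplitudeAtHalf_of_isingCapacityAxialAt`) and STUB (β) below `(3 − s)/2` (imported
`stub_windowOfAxialCapacityAt`); the whole window needs every `s > 3/2` (`noGaussianWindowLimit_of_isingCapacityAxialAll`).
[cite: Aizenman1982, §1] -/
theorem noGaussianWindowLimit_below_of_isingCapacityAxial
    (hcap : ∃ s : ℝ, 0 < s ∧ s < 2 ∧ ∀ K lam nu : ℝ, 0 < K → 0 < lam → 0 < nu →
      ∃ c' : ℝ, 0 < c' ∧ c' ≤ 1 ∧ ∃ R₀ : ℝ, ∀ c e : Site 3, (∀ j : Fin 3, j ≠ 0 → e j = c j) →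
        R₀ ≤ ‖c - e‖ → ∀ᶠ L : ℕ in atTop, ∀ C : Finset (Site 3), c ∉ C → e ∉ C →
          IsSpreadDefect s K lam nu c e C → defectG L C c e ≤ (1 - c') * boxG L c e) :
    ∃ s : ℝ, s < 2 ∧ ∀ (ρ : ℝ → ℝ) (Δ : ℝ) (S : CorrFamily 3), (∀ δ ∈ Set.Ioc (0:ℝ) 1, 0 < ρ δ) →
      HasPointwiseScalingLimit (criticalCorr 3) ρ S → IsNondegenerateTwoPoint S →
      IsMoebiusCovariant Δ S → Δ < (3 - s) / 2 → HasNontrivialU4 S := by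
  obtain ⟨s, hs₀, hs₂, hcap⟩ := hcap
  exact ⟨s, hs₂, stub_windowOfAxialCapacityAt s hs₀ hcap⟩

/-! ## Exactness: every stub is implied by the crux (no leaf is stronger than needed) -/

/-- The crux implies STUB (β): a Gaussian Möbius limit would have `Δ = 1/2` (`crux_iff_half_and_amplitude`),
contradicting `1/2 < Δ`. [folklore] -/
theorem noGaussianWindowLimit_of_crux
    (h : Summit.CriticalPhenomena.Ising3DConformalLimit.Theses.PerfectScreening.GaussianLimitNotScreened) :
    ∀ (ρ : ℝ → ℝ) (Δ : ℝ) (S : CorrFamily 3), (∀ δ ∈ Set.Ioc (0:ℝ) 1, 0 < ρ δ) →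
      HasPointwiseScalingLimit (criticalCorr 3) ρ S → IsNondegenerateTwoPoint S →
      IsMoebiusCovariant Δ S → 1 / 2 < Δ → Δ < 3 / 4 → HasNontrivialU4 S := by
  intro ρ Δ S hρ hlim hnd hM hgt _
  by_contra hU4
  have hΔ := ((crux_iff_half_and_amplitude.1 h) ρ Δ S hρ hlim hnd hM hU4).1
  exact absurd hΔ (ne_of_gt hgt)

/-- The crux implies STUB (γ): a Gaussian Möbius limit would have `Δ = 1/2 ≠ 3/4`. [folklore] -/
theorem noMarginalGaussianLimit_of_crux
    (h : Summit.CriticalPhenomena.Ising3DConformalLimit.Theses.PerfectScreening.GaussianLimitNotScreened) :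
    ∀ (ρ : ℝ → ℝ) (S : CorrFamily 3), (∀ δ ∈ Set.Ioc (0:ℝ) 1, 0 < ρ δ) →
      HasPointwiseScalingLimit (criticalCorr 3) ρ S → IsNondegenerateTwoPoint S →
      IsMoebiusCovariant (3 / 4) S → HasNontrivialU4 S := by
  intro ρ S hρ hlim hnd hM
  by_contra hU4
  have hΔ := ((crux_iff_half_and_amplitude.1 h) ρ (3 / 4) S hρ hlim hnd hM hU4).1
  norm_num at hΔ

/-- The crux implies STUB (α) verbatim (the amplitude half of `crux_iff_half_and_amplitude`). [folklore] -/
theorem amplitudeAtHalf_of_crux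
    (h : Summit.CriticalPhenomena.Ising3DConformalLimit.Theses.PerfectScreening.GaussianLimitNotScreened) :
    ∀ (ρ : ℝ → ℝ) (S : CorrFamily 3), (∀ δ ∈ Set.Ioc (0:ℝ) 1, 0 < ρ δ) →
      HasPointwiseScalingLimit (criticalCorr 3) ρ S → IsNondegenerateTwoPoint S →
      IsMoebiusCovariant (1/2) S → ¬ HasNontrivialU4 S →
      ¬ Tendsto (fun m : ℕ => ρ (1 / m) ^ 2 / m) atTop atTop :=
  fun ρ S hρ hlim hnd hM hU4 => ((crux_iff_half_and_amplitude.1 h) ρ (1/2) S hρ hlim hnd hM hU4).2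

/-! ## Payers: each stub from an EXISTING named open statement, by landed bridges (kernel-checked map) -/

/-- STUB (β) from item stmt-CriticalPhenomena-0636 `IsingEuclidUpgradeR4NonGaussian` (every non-degenerate pointwise
limit of `criticalCorr 3` is non-Gaussian): immediate. [cite: Aizenman1982, §1] -/
theorem noGaussianWindowLimit_of_r4NonGaussian
    (h : Summit.CriticalPhenomena.Ising3DConformalLimit.Theses.IsingEuclidUpgrade.IsingEuclidUpgradeR4NonGaussian) :
    ∀ (ρ : ℝ → ℝ) (Δ : ℝ) (S : CorrFamily 3), (∀ δ ∈ Set.Ioc (0:ℝ) 1, 0 < ρ δ) →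
      HasPointwiseScalingLimit (criticalCorr 3) ρ S → IsNondegenerateTwoPoint S →
      IsMoebiusCovariant Δ S → 1 / 2 < Δ → Δ < 3 / 4 → HasNontrivialU4 S :=
  fun ρ _ S hρ hlim hnd _ _ _ => h ρ S hρ hlim hnd

/-- STUB (β) from item stmt-CriticalPhenomena-2601 `GaussianLimitIsFree` (a Gaussian translation-invariant
scale-covariant limit of the nearest-neighbour model has `Δ = 1/2`): contradiction with `1/2 < Δ`.
[cite: Kotani1973, Theorem 2] -/
theorem noGaussianWindowLimit_of_gaussianLimitIsFree
    (hfree : Summit.CriticalPhenomena.Ising3DConformalLimit.Theses.AnomalousForcesInteraction.GaussianLimitIsFree) :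
    ∀ (ρ : ℝ → ℝ) (Δ : ℝ) (S : CorrFamily 3), (∀ δ ∈ Set.Ioc (0:ℝ) 1, 0 < ρ δ) →
      HasPointwiseScalingLimit (criticalCorr 3) ρ S → IsNondegenerateTwoPoint S →
      IsMoebiusCovariant Δ S → 1 / 2 < Δ → Δ < 3 / 4 → HasNontrivialU4 S := by
  intro ρ Δ S hρ hlim hnd hM hgt _
  by_contra hU4
  have hΔ : Δ = 1 / 2 := hfree ρ Δ S hρ hlim hnd hM.isEuclideanInvariant.1 hM.isScaleCovariant hU4
  exact absurd hΔ (ne_of_gt hgt)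

/-- STUB (β) from the karamata line's hypothesis-free `stub_isingCapacity` (defect depletion for spread defects of
dimension `s > 3/2`), through the landed fat spread cluster + depletion engine
`hasNontrivialU4_of_lt_threeQuarters_of_capacity` (p102368). [cite: AizenmanDuminilCopinAnnals2021, App. A Lemma A.1] -/
theorem noGaussianWindowLimit_of_isingCapacity
    (hcap : ∀ s : ℝ, 3 / 2 < s → ∀ K lam nu : ℝ, 0 < K → 0 < lam → 0 < nu →
        ∃ c' : ℝ, 0 < c' ∧ c' ≤ 1 ∧ ∃ R₀ : ℝ, ∀ c e : Site 3, R₀ ≤ ‖c - e‖ →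
          ∀ᶠ L : ℕ in atTop, ∀ C : Finset (Site 3), c ∉ C → e ∉ C →
            IsSpreadDefect s K lam nu c e C → defectG L C c e ≤ (1 - c') * boxG L c e) :
    ∀ (ρ : ℝ → ℝ) (Δ : ℝ) (S : CorrFamily 3), (∀ δ ∈ Set.Ioc (0:ℝ) 1, 0 < ρ δ) →
      HasPointwiseScalingLimit (criticalCorr 3) ρ S → IsNondegenerateTwoPoint S →
      IsMoebiusCovariant Δ S → 1 / 2 < Δ → Δ < 3 / 4 → HasNontrivialU4 S :=
  fun _ _ _ hρ hlim hnd hM _ hlt =>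
    hasNontrivialU4_of_lt_threeQuarters_of_capacity hcap hρ hlim hnd (scaleCovariantOn_of_isMoebiusCovariant hM) hlt

/-- STUB (γ) from item stmt-CriticalPhenomena-5507 `WindowBelowHalf` (landed bridge, p102368).
[cite: DuminilCopinPanis2025LowerBounds, Theorem 1.5] -/
theorem noMarginalGaussianLimit_of_windowBelowHalf'
    (hwin : Summit.CriticalPhenomena.Ising3DConformalLimit.Theses.LatticeSDPCertificates.WindowBelowHalf) :
    ∀ (ρ : ℝ → ℝ) (S : CorrFamily 3), (∀ δ ∈ Set.Ioc (0:ℝ) 1, 0 < ρ δ) →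
      HasPointwiseScalingLimit (criticalCorr 3) ρ S → IsNondegenerateTwoPoint S →
      IsMoebiusCovariant (3 / 4) S → HasNontrivialU4 S :=
  noMarginalGaussianLimit_of_windowBelowHalf hwin

/-- STUB (γ) from item stmt-CriticalPhenomena-5504 `CertifiedWindow` (route LatticeSDPCertificates' open crux): with
the LANDED `criticalStateFeasible_proof` (item 5506) it gives `WindowBelowHalf` (`windowBelowHalf_of_certifiedWindow`),
hence the corner. [cite: DuminilCopinPanis2025LowerBounds, Theorem 1.5] -/
theorem noMarginalGaussianLimit_of_certifiedWindow
    (hCW : Summit.CriticalPhenomena.Ising3DConformalLimit.Theses.LatticeSDPCertificates.CertifiedWindow) :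
    ∀ (ρ : ℝ → ℝ) (S : CorrFamily 3), (∀ δ ∈ Set.Ioc (0:ℝ) 1, 0 < ρ δ) →
      HasPointwiseScalingLimit (criticalCorr 3) ρ S → IsNondegenerateTwoPoint S →
      IsMoebiusCovariant (3 / 4) S → HasNontrivialU4 S :=
  noMarginalGaussianLimit_of_windowBelowHalf
    (Summit.CriticalPhenomena.Ising3DConformalLimit.Theorems.windowBelowHalf_of_certifiedWindow hCW
      Summit.CriticalPhenomena.Ising3DConformalLimit.Theorems.criticalStateFeasible_proof)

/-- STUB (γ) from item stmt-CriticalPhenomena-15703 `SubPtolemyFloor` ALONE (landed bridge of this seat, p142307: the floor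
gives `η < log₂(1+√2) − 1 < 1/2` whenever `η` exists, and a corner limit has `η = 1/2`). [cite: DuminilCopinPanis2025LowerBounds, Theorem 1.5] -/
theorem noMarginalGaussianLimit_of_subPtolemyFloor'
    (hF : Summit.CriticalPhenomena.Ising3DConformalLimit.Theses.SubPtolemyInterlacing.SubPtolemyFloor) :
    ∀ (ρ : ℝ → ℝ) (S : CorrFamily 3), (∀ δ ∈ Set.Ioc (0:ℝ) 1, 0 < ρ δ) →
      HasPointwiseScalingLimit (criticalCorr 3) ρ S → IsNondegenerateTwoPoint S →
      IsMoebiusCovariant (3 / 4) S → HasNontrivialU4 S :=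
  noMarginalGaussianLimit_of_subPtolemyFloor hF

/-- STUB (β) from items stmt-CriticalPhenomena-15702 `Interlacing` ∧ stmt-CriticalPhenomena-15703 `SubPtolemyFloor` (landed bridge of
this seat, p142830: `Interlacing` below `2Δ < log₂(1+√2)`, the floor above). [cite: DuminilCopinPanis2025LowerBounds, Theorem 1.5] -/
theorem noGaussianWindowLimit_of_interlacing_of_subPtolemyFloor'
    (hI : Summit.CriticalPhenomena.Ising3DConformalLimit.Theses.SubPtolemyInterlacing.Interlacing)
    (hF : Summit.CriticalPhenomena.Ising3DConformalLimit.Theses.SubPtolemyInterlacing.SubPtolemyFloor) :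
    ∀ (ρ : ℝ → ℝ) (Δ : ℝ) (S : CorrFamily 3), (∀ δ ∈ Set.Ioc (0:ℝ) 1, 0 < ρ δ) →
      HasPointwiseScalingLimit (criticalCorr 3) ρ S → IsNondegenerateTwoPoint S →
      IsMoebiusCovariant Δ S → 1 / 2 < Δ → Δ < 3 / 4 → HasNontrivialU4 S :=
  noGaussianWindowLimit_of_interlacing_of_subPtolemyFloor hI hF

/-- STUB (γ) from item stmt-CriticalPhenomena-2601 `GaussianLimitIsFree` (landed bridge, p102368).
[cite: Kotani1973, Theorem 2] -/
theorem noMarginalGaussianLimit_of_gaussianLimitIsFree'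
    (hfree : Summit.CriticalPhenomena.Ising3DConformalLimit.Theses.AnomalousForcesInteraction.GaussianLimitIsFree) :
    ∀ (ρ : ℝ → ℝ) (S : CorrFamily 3), (∀ δ ∈ Set.Ioc (0:ℝ) 1, 0 < ρ δ) →
      HasPointwiseScalingLimit (criticalCorr 3) ρ S → IsNondegenerateTwoPoint S →
      IsMoebiusCovariant (3 / 4) S → HasNontrivialU4 S :=
  noMarginalGaussianLimit_of_gaussianLimitIsFree hfree

/-- STUB (α) from crux stmt-CriticalPhenomena-13885's registered open stub `stub_isingCapacityAxial` (axial Ising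
capacity at one exponent `s < 2`, written out verbatim), via the landed `amplitudeAtHalf_of_isingCapacityAxial'`
(p128872: Aizenman's criterion at the axial quadruple). [cite: Aizenman1982, §1] -/
theorem amplitudeAtHalf_of_isingCapacityAxial
    (hcap : ∃ s : ℝ, 0 < s ∧ s < 2 ∧ ∀ K lam nu : ℝ, 0 < K → 0 < lam → 0 < nu →
      ∃ c' : ℝ, 0 < c' ∧ c' ≤ 1 ∧ ∃ R₀ : ℝ, ∀ c e : Site 3, (∀ j : Fin 3, j ≠ 0 → e j = c j) →
        R₀ ≤ ‖c - e‖ → ∀ᶠ L : ℕ in atTop, ∀ C : Finset (Site 3), c ∉ C → e ∉ C →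
          IsSpreadDefect s K lam nu c e C → defectG L C c e ≤ (1 - c') * boxG L c e) :
    ∀ (ρ : ℝ → ℝ) (S : CorrFamily 3), (∀ δ ∈ Set.Ioc (0:ℝ) 1, 0 < ρ δ) →
      HasPointwiseScalingLimit (criticalCorr 3) ρ S → IsNondegenerateTwoPoint S →
      IsMoebiusCovariant (1/2) S → ¬ HasNontrivialU4 S →
      ¬ Tendsto (fun m : ℕ => ρ (1 / m) ^ 2 / m) atTop atTop :=
  amplitudeAtHalf_of_isingCapacityAxial' hcap

/-- STUB (α) from item stmt-CriticalPhenomena-0636 (vacuity: no Gaussian limit at all). [cite: Aizenman1982, §1] -/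
theorem amplitudeAtHalf_of_r4NonGaussian
    (h : Summit.CriticalPhenomena.Ising3DConformalLimit.Theses.IsingEuclidUpgrade.IsingEuclidUpgradeR4NonGaussian) :
    ∀ (ρ : ℝ → ℝ) (S : CorrFamily 3), (∀ δ ∈ Set.Ioc (0:ℝ) 1, 0 < ρ δ) →
      HasPointwiseScalingLimit (criticalCorr 3) ρ S → IsNondegenerateTwoPoint S →
      IsMoebiusCovariant (1/2) S → ¬ HasNontrivialU4 S →
      ¬ Tendsto (fun m : ℕ => ρ (1 / m) ^ 2 / m) atTop atTop :=
  fun ρ S hρ hlim hnd _ hU4 _ => hU4 (h ρ S hρ hlim hnd)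

/-- STUB (α) from item stmt-CriticalPhenomena-1343 `GaussianLimitIsCoulomb` (the rev-3 strong form: a Gaussian
Möbius limit forces the Coulomb lower bound `c/‖x‖ ≤ G`): a Coulomb lower bound is incompatible with perfect
screening, which at `Δ = 1/2` is `ρ(1/m)²/m → ∞` (`screened_iff_renorm`). [folklore] -/
theorem amplitudeAtHalf_of_gaussianLimitIsCoulomb
    (hC : Summit.CriticalPhenomena.Ising3DConformalLimit.Theses.PerfectScreening.GaussianLimitIsCoulomb) :
    ∀ (ρ : ℝ → ℝ) (S : CorrFamily 3), (∀ δ ∈ Set.Ioc (0:ℝ) 1, 0 < ρ δ) →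
      HasPointwiseScalingLimit (criticalCorr 3) ρ S → IsNondegenerateTwoPoint S →
      IsMoebiusCovariant (1/2) S → ¬ HasNontrivialU4 S →
      ¬ Tendsto (fun m : ℕ => ρ (1 / m) ^ 2 / m) atTop atTop := by
  intro ρ S hρ hlim hnd hM hU4 hT
  obtain ⟨c, hc, hcoul⟩ := hC ρ (1/2) S hρ hlim hnd hM hU4
  have hscr : Tendsto (fun x : Site 3 => ‖x‖ * criticalTwoPoint 3 x) cofinite (𝓝 0) :=
    (screened_iff_renorm hlim hnd).2 hT
  have hev : ∀ᶠ x : Site 3 in cofinite, ‖x‖ * criticalTwoPoint 3 x < c := hscr.eventually (gt_mem_nhds hc)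
  obtain ⟨x, hx, hx0⟩ := (hev.and (eventually_cofinite_ne 0)).exists
  have hle : c / ‖x‖ ≤ criticalTwoPoint 3 x := hcoul x hx0
  have hn : 0 < ‖x‖ := norm_pos_iff.2 hx0
  rw [div_le_iff₀ hn] at hle
  linarith [mul_comm ‖x‖ (criticalTwoPoint 3 x)]

/-! ### Interlacing payers (LANDED in this namespace, p137971 — imported, not redeclared)
`stub_interlacingPaysAmplitude : Interlacing → (α)`; `noGaussianLimitBelowThreshold_of_interlacing`;
`noGaussianWindowLimit_below_of_interlacing` ((β) on `2Δ < log₂(1+√2)`);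
`noGaussianWindowLimit_of_interlacing_of_upperWindow`; `gaussianLimitNotScreened_of_interlacing_of_upperWindow_of_corner`;
`gaussianLimitNotScreened_of_interlacing_of_gaussianLimitIsFree`; `gaussianLimitNotScreened_of_interlacing_of_conditionalEta`;
`gaussianLimitNotScreened_of_interlacing_of_subPtolemyFloor`. Sanity uses below (kernel re-check of the wiring). -/

/-- (α) from `Interlacing`, through the landed bridge (re-stated against THIS file's registered stub text).
[cite: Aizenman1982, §1] -/
theorem amplitudeAtHalf_of_interlacing
    (hI : Summit.CriticalPhenomena.Ising3DConformalLimit.Theses.SubPtolemyInterlacing.Interlacing) :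
    ∀ (ρ : ℝ → ℝ) (S : CorrFamily 3), (∀ δ ∈ Set.Ioc (0:ℝ) 1, 0 < ρ δ) →
      HasPointwiseScalingLimit (criticalCorr 3) ρ S → IsNondegenerateTwoPoint S →
      IsMoebiusCovariant (1/2) S → ¬ HasNontrivialU4 S →
      ¬ Tendsto (fun m : ℕ => ρ (1 / m) ^ 2 / m) atTop atTop :=
  stub_interlacingPaysAmplitude hI

/-! GIVEN `Interlacing`, the crux closes from the UPPER-window part of STUB (β) and STUB (γ) alone — landed as
`gaussianLimitNotScreened_of_interlacing_of_upperWindow_of_corner` (p137971); not re-derived here so that the ONLY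
theorem of this file concluding the crux decl is the unconditional composition `GaussianLimitNotScreened_of`. -/

/-! Items-level compositions of these payers into the whole crux are already LANDED and not repeated here:
`SingleLayerLinearRegression.gaussianLimitNotScreened_of_r4NonGaussian` (crux ⟸ item 0636, p130361),
`…gaussianLimitNotScreened_of_gaussianLimitIsFree_of_isingCapacityAxial` (crux ⟸ 2601 ∧ 13885-stub, p130361),
`KaramataAmplitudeBlindMerging.gaussianLimitNotScreened_of_capacity_of_windowBelowHalf` (p102368), and the split glue
`PerfectScreeningGaussianLimitNotScreenedSplit.gaussianLimitNotScreened_of_subs` (this seat). -/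

/-! ## The composition: the three stubs ⇒ the crux, BY NAME (the strategist's glue, LANDED p137467) -/

/-- **`GaussianLimitNotScreened` from STUBS (β), (γ), (α) — THE SKELETON THEOREM.** Literally the landed split glue
`PerfectScreeningGaussianLimitNotScreenedSplit.gaussianLimitNotScreened_of_subs` (p137467) applied to the three registered
stubs: by the window `Δ ∈ [1/2, 3/4]` (`dimension_window_and_eta`) only three regimes occur; in the open window (β) and
at the corner (γ) the limit is not Gaussian, contradicting `U₄ ≡ 0`; at `Δ = 1/2` perfect screening is
`ρ(1/m)²/m → ∞` (`screened_iff_renorm`), which (α) forbids. [cite: DuminilCopinPanis2025LowerBounds, Theorem 1.5] -/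
theorem GaussianLimitNotScreened_of :
    Summit.CriticalPhenomena.Ising3DConformalLimit.Theses.PerfectScreening.GaussianLimitNotScreened :=
  gaussianLimitNotScreened_of_subs stub_noGaussianWindowLimit stub_noMarginalGaussianLimit stub_amplitudeAtHalf

end Summit.CriticalPhenomena.Ising3DConformalLimit.Cruxes.GaussianLimitNotScreened.FreeRegularVariationDcpWindow

end
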